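/-
Copyright: lit-balaban cell, Phase-2 proof seat p33 (gen 9).  Statement-level skeleton of a published paper; no proof claims beyond
what the kernel checks below.
-/
import Literature.MathematicalPhysics.QuantumFieldTheory.BalabanImbrieJaffe1984to88.BIJ85SmoothPotential326
import Literature.MathematicalPhysics.QuantumFieldTheory.BalabanImbrieJaffe1984to88.BIJ88Smooth43Axial

/-!
# `BalabanImbrieJaffe1984to88.BIJ85LocalSmoothGauge326` — T. Bałaban, J. Imbrie, A. Jaffe, *Renormalization of the Higgs model:
minimizers, propagators and the stability of mean field theory*, Commun. Math. Phys. **97** (1985) 299–329 [BalabanImbrieJaffe1985],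
Sect. 7.3 p. 326 [PDF 28], the closing paragraph: **THE LOCAL SMOOTH GAUGE OF THE ACTUAL BACKGROUND (4.5.4) UNDER (7.3.1)** —
*"by change of gauge u_k can be transformed in a local region Λ into a configuration of the form exp[ie_kηA], where A is smooth and small"* —
file 2 of 2: on every box `Λ` of the η-torus that does not wrap around, `u_k(b) = exp(ie_k((∂λ)(b) + ηA(b)))` for ALL bonds `b` of `Λ`, with
`A = H_kB + a_h` (the Landau minimizer of file 1 plus an explicit linear potential of the flux part `h`) SMOOTH AND SMALL:
`|A|, |L^k(A(· + ηe_λ) − A)| ≤ K·(1 + d(|Λ|η + 1))²·𝓅(e_k)`, ONE `K` for all tori and all scales.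

statement-level skeleton of published theorems with citation tags; proofs where landed; nothing here is a claim about the Yang–Mills mass gap

PDF held: `paper:balaban1985-cmp97-bij-higgs-minimizers` (journal page = PDF page + 298); p. 326 [PDF 28] read this session (text layer).

CITATION HEADER (lean-in-tree rule).  Phase-2 file of the lit-balaban TYPED SKELETON (HOME `run/shared/lean/pub/lit-balaban/`), seat p33
gen 9 (unit `lit-balaban-p33-g9`; TAKING line HOME/STATUS.md 2026-08-22T00:17Z); SKELETON row **C1.Eq7.3.1-7.3.2** (owner r15, referee
ref-5): the printed HYPOTHESIS of the regularity member of the p. 326 sentence (*"The propagators arising from Δ_k(u_k) … also satisfy the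
regularity and decay estimates of [7]"*, [7] = [Balaban1983RegularityDecay], whose Theorem p. 573 is stated for `U(A) = e^{qeηA}` with `A`
regular) — G-C1-05 ADDENDUM 6 «WHAT REMAINS» (a); and the η-lattice passage for `u_k` that p36's `BIJ88Smooth43Axial` (row C2.Eq4.3 /
C2.Claim@286 of [BalabanImbrieJaffe1988], *"ũ^λ = exp(ie_kηA^λ) with |A^λ|, |∂A^λ|, |∂^*A^λ| ≦ cp(e_k)r(e_k)"*) names as NOT touched in
its honest scope (*"the axial gauge alone does NOT give the ∂^*-bound at lattice spacing ζ < 1"* — here the potential is the Landau minimizer,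
all of whose η-difference quotients are bounded).  Objects BY NAME: file 1 (`exists_smooth_potential_allTori`, `plaq_actualBg_eq_exp_hodge`),
p36's U(1) axial Poincaré lemma on non-wrapping boxes `BIJ88Smooth43Axial.cfg_eq_exp_grad_add_axialB` / `abs_axialB_le` (used at `a = 0`:
a FLAT field on a box is a pure gauge), the torus box vocabulary `T4AxialGaugeSmallField.castSite`/`boxBonds`/`boxPlaqs`, p34's carrier
dictionary `BIJ88Sect3Rescaling.fieldEquiv`, r18's `plaqVar_coe`, p30's `expField`/`plaq_expField`.  ONE definition with body (the linear
potential `linPot` of a constant plaquette field on a box); no `Prop`-valued definition, no named fact (D-0026).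

THE PRINTED TEXT, verbatim, p. 326 [PDF 28]: *"In order to remain within the framework of this reference, we remark that by change of gauge u_k
can be transformed in a local region Λ into a configuration of the form exp[ie_kηA], where A is smooth and small. … This is a local procedure
since f^{(k)} can locally be represented as a curl."*

THE ARGUMENT.  File 1: `u_k(∂p) = exp(ie_kη²(h_{μν} + (∂^ηH_kB)(p)))` on every η-plaquette, `|H_kB|, |∇^ηH_kB| ≤ K𝓅(e_k)(1 + |z_k − x₀|₁)²`.
On a box `Λ = [lo, lo + n]` of the η-torus (`n < sitesPerDir`) the constant `h` is the η-curl of the linear potential `a_h(⟨z, ν⟩) =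
η·Σ_{μ<ν} h_{μν}(z_μ − lo_μ)` (`∂^ηa_h = h` on the plaquettes of `Λ`, `|a_h| ≤ η·d·n·max|h|`, `L^k(a_h(z + e_λ) − a_h(z)) = h_{λν}` or `0`), so
the fine field `U = exp[ie_kη(H_kB + a_h)]` has the same plaquette variables as `u_k` on `Λ`; the ratio `u_k·U⁻¹` is FLAT on `Λ`, hence — the
U(1) lattice Poincaré lemma on the box, p36's axial gauge with plaquette bound `0` — a pure gauge `exp(ie_k∂λ)` there:
`u_k(b) = exp(ie_k((∂λ)(b) + ηA(b)))` on every bond of `Λ`.  With `x₀ = (lo)_k` and `|z_k − (lo)_k|₁ ≤ d(nη + 1)` for `z ∈ Λ` the bounds of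
file 1 become *"estimates depending on Λ"*: `K·(1 + d(nη + 1))²·𝓅(e_k)`, `nη` = the side of `Λ` in the unit of `T₁^{(k)}`.

WHAT IS PROVED (0 `sorry`, standard axioms).
* §1 the box: `supDist_castSite_le` (`|z − lo|_∞ ≤ n` on the torus for `z ∈ [lo, lo + n]`), **`tdist_blk_le_of_box`** (`|z_k − lo_k|₁ ≤ d(nη + 1)`).
* §2 the linear potential `linPot lo hi η h` of a constant plaquette field: `linPot_castSite`, **`curl_linPot`** (`∂^{c}a_h = cη·h` on the box
  plaquettes), `abs_linPot_le`, `abs_fwdDiff_linPot_le`.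
* §3 `plaq_expField_eq_exp_curl` (`exp[ie_kηA](∂p) = exp(ie_kη²(∂^{η⁻¹}A)(p))`), `plaq_ratio_eq_one` (equal plaquettes ⇒ flat ratio).
* §4 **`eq_exp_grad_add_of_plaq_eq`** — THE U(1) POINCARÉ LEMMA AT PLAQUETTE BOUND `0`: two fine `U(1)` fields with the same plaquette variables
  on a non-wrapping box differ there by a pure gauge: `u(b) = exp(ie((∂λ)(b) + ηA(b)))` on the box bonds when `u(∂p) = exp[ieηA](∂p)` on the box
  plaquettes (p36's `cfg_eq_exp_grad_add_axialB` + `abs_axialB_le` at `a = 0` for the ratio).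
* §5 **`exists_local_smooth_gauge`** (one torus, one scale, given `h`, `B` with the curvature identity of file 1): on every non-wrapping box,
  `u_k(b) = exp(ie_k((∂λ)(b) + η(H_kB + a_h)(b)))` for all box bonds.
* §6 **`exists_local_smooth_gauge_allTori` — THE p. 326 REMARK, HYPOTHESIS-FREE, ONE CONSTANT FOR ALL TORI AND SCALES**: for every `d ≥ 2`, `L`
  there is `K ≥ 0` such that on every torus (`P.d = d`, `P.L = L`), every scale `1 ≤ k ≤ m + K`, every `e > 0`, every unit field `v` with
  `|v(∂p) − 1| ≤ t ≤ ½`, and every box `[lo, lo + n]` of the η-torus with `n < sitesPerDir 0`, there are `λ` and `A` with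
  `u_k(b) = exp(ie((∂λ)(b) + ηA(b)))` on the box bonds, `|A(b)| ≤ K(1 + d(nη + 1))²·(t/e)` on the box bonds and
  `|L^k(A(⟨z + e_λ, ν⟩) − A(⟨z, ν⟩))| ≤ K(1 + d(nη + 1))²·(t/e)` whenever `z, z + e_λ ∈ [lo, lo + n]`; **`exists_local_smooth_gauge_of_hyp731`**:
  under (7.3.1) verbatim the factor `t/e` is `𝓅(e_k)` — *"A is smooth and small … with estimates depending on Λ"*.
HONEST SCOPE.  (i) Boxes that do not wrap around the torus (`n < sitesPerDir 0`), as in `T4AxialGaugeSmallField`/`BIJ88Smooth43Axial`; the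
potential `A` itself is defined on the whole torus (file 1) and only the gauge equivalence is local — necessarily: `u_k` and `exp[ie_kηA]` may
differ by torus-cycle holonomies.  (ii) "smooth" = sup of `A` and of all its forward η-difference quotients on the box (so `|∂A| ≤ 2·`, `|∂^*A| ≤
2d·` the same bound); no Hölder quotient.  (iii) The regularity estimates of [7] for `G_k(u_k)` (the conclusion of the p. 326 sentence) are NOT
proved — this is their printed hypothesis; HOME/GAPS.md G-C1-05.  (iv) `U = 1` real abelian fields; standing range `k ≤ m + K`, `2 ≤ d`;
constants explicit, not optimised.  Unit `lit-balaban-p33` (literature-prover-lit-balaban-p33-g9-0), 2026-08-22.  NOT summit progress.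
-/

open scoped BigOperators RealInnerProductSpace

namespace Literature.MathematicalPhysics.QuantumFieldTheory.BalabanImbrieJaffe1984to88.BIJ85LocalSmoothGauge326

open Balaban1983to89 hiding Site Plaq
open Balaban1983to89.LatticeFieldCalculus
open Balaban1983to89.T4AxialGaugeSmallField (castSite castSite_apply castSite_add_e castSite_injOn_box boxBonds boxPlaqs axialGauge)
open BIJ85AxialPropagator411 BIJ85Prop521Torus BIJ85Sigma421Torus BIJ85Eq611Torus BIJ85Prop522Torus BIJ85Sigma422Eta
open BIJ85Ineq722Torus (mul_supDist_blk_le)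
open BIJ85GaugeFunction5113 (blk)
open Balaban1983to89.B3TorusRadialSums (cdist cdist_le_val supDist_eq_sup_cdist tdist_le_mul_supDist supDist_comm)
open Balaban1983to89.B7Prop1Explicit (e e_apply)
open Balaban1983to89.B8Lemma1NonAbelian (e_nonneg)
open BIJ85Sect1Model (U1Field plaq)
open BIJ85SmallFieldSplit64 (plaqField expField curl1 plaq_expField)
open BIJ85Eq454Holonomy (curl_eq_mul_curl1)
open BIJ85Eq454PlaqResidual (actualBg actualBgU1 eta_mul_L_pow)
open BIJ88Sect3Statements (U1 toC cfg plaqVar gaugeU)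
open BIJ88Sect4Statements (Smooth43)
open BIJ88Sect3Rescaling (fieldEquiv cfg_fieldEquiv)
open BIJ88Sect3ModelBridge (plaqVar_coe)
open BIJ88Ineq217NearPart (bonds_mem_boxBonds)
open BIJ88Smooth43Axial (lamOf axialB cfg_eq_exp_grad_add_axialB abs_axialB_le)
open BIJ85SmoothPotential326 (exists_smooth_potential_allTori dev_nonneg)
open B6SectAOntoV1 (blk_eq_iterBlockOf)
open B5Eq118OneStroke (iterBlockOf)
open Complex
-- inside this namespace the bare `Site`/`Plaq` are the `ℤ^d` carriers of the QFT root; the torus ones are renamed: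
open Balaban1983to89 renaming Site → TSite, Plaq → TPlaq

noncomputable section

variable {P : Params} {j : ℕ}

/-! ## §1  The box `[lo, lo + n]` of the torus: extent and block diameter -/

/-- `|z − lo|_∞ ≤ n` ON THE TORUS for `z ∈ [lo, hi]`, `hi ≤ lo + n` (each coordinate residue is at most `z_κ − lo_κ ≤ n`). [folklore] -/
private theorem supDist_castSite_le {lo hi : Fin P.d → ℤ} {n : ℕ} (hn : ∀ κ, hi κ ≤ lo κ + n) {z : Fin P.d → ℤ} (hz : lo ≤ z)
    (hz' : z ≤ hi) : supDist (castSite z : TSite P j) (castSite lo) ≤ n := by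
  rw [supDist_eq_sup_cdist]
  refine Finset.sup_le fun κ _ => ?_
  have h0 : 0 ≤ z κ - lo κ := sub_nonneg.2 (hz κ)
  have h1 : z κ - lo κ ≤ n := by have := hz' κ; have := hn κ; linarith
  have hcast : (castSite z : TSite P j) κ - (castSite lo : TSite P j) κ = (((z κ - lo κ).toNat : ℕ) : ZMod (P.sitesPerDir j)) := by
    rw [castSite_apply, castSite_apply, ← Int.cast_sub, ← Int.toNat_of_nonneg h0, Int.cast_natCast, Int.toNat_of_nonneg h0]
  rw [hcast]
  refine (cdist_le_val _).trans ?_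
  rw [ZMod.val_natCast]
  refine (Nat.mod_le _ _).trans ?_
  omega

/-- **THE BLOCK DIAMETER OF A BOX**: for `z ∈ [lo, lo + n]` on the fine torus `T^{(0)}` (`k ≤ m + K`), `|z_k − lo_k|₁ ≤ d·(nη + 1)` (`z_k` = the
`k`-block of `z`, `η = L^{−k}`): `L^k|z_k − lo_k|_∞ ≤ |z − lo|_∞ + L^k − 1` (p09's `mul_supDist_blk_le`) and `|·|₁ ≤ d|·|_∞`.
[cite: BalabanImbrieJaffe1985, (5.1.2)–(5.1.3) p.313] -/
theorem tdist_blk_le_of_box {k : ℕ} (hk : k ≤ P.m + P.K) {lo hi : Fin P.d → ℤ} {n : ℕ} (hn : ∀ κ, hi κ ≤ lo κ + n)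
    {z : Fin P.d → ℤ} (hz : lo ≤ z) (hz' : z ≤ hi) :
    ((blk k (castSite z : TSite P 0)).tdist (blk k (castSite lo : TSite P 0)) : ℝ) ≤ P.d * ((n : ℝ) * P.eta k + 1) := by
  have hL : (0 : ℝ) < (P.L : ℝ) ^ k := pow_pos P.cast_L_pos k
  have h1 := mul_supDist_blk_le hk (castSite z : TSite P 0) (castSite lo)
  have h2 := supDist_castSite_le (j := 0) hn hz hz'
  have h3 : P.L ^ k * supDist (iterBlockOf k (castSite z : TSite P 0)) (iterBlockOf k (castSite lo)) ≤ n + P.L ^ k := by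
    have := Nat.one_le_pow k P.L P.L_pos; omega
  have h4 : (supDist (blk k (castSite z : TSite P 0)) (blk k (castSite lo)) : ℝ) ≤ (n : ℝ) * P.eta k + 1 := by
    rw [blk_eq_iterBlockOf, blk_eq_iterBlockOf]
    have h5 : ((P.L : ℝ) ^ k) * (supDist (iterBlockOf k (castSite z : TSite P 0)) (iterBlockOf k (castSite lo)) : ℝ) ≤ n + (P.L : ℝ) ^ k := by
      exact_mod_cast h3
    have h6 : (supDist (iterBlockOf k (castSite z : TSite P 0)) (iterBlockOf k (castSite lo)) : ℝ) ≤ ((n : ℝ) + (P.L : ℝ) ^ k) / (P.L : ℝ) ^ k := by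
      rw [le_div_iff₀ hL, mul_comm]
      exact h5
    refine h6.trans (le_of_eq ?_)
    rw [add_div, div_self hL.ne', div_eq_mul_inv, ← eta_inv, inv_inv]
  have hd : (0 : ℝ) ≤ P.d := Nat.cast_nonneg _
  calc ((blk k (castSite z : TSite P 0)).tdist (blk k (castSite lo : TSite P 0)) : ℝ)
      ≤ P.d * (supDist (blk k (castSite z : TSite P 0)) (blk k (castSite lo)) : ℝ) := by
        exact_mod_cast tdist_le_mul_supDist _ _
    _ ≤ P.d * ((n : ℝ) * P.eta k + 1) := mul_le_mul_of_nonneg_left h4 hd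

/-! ## §2  The linear potential of a constant plaquette field on a box -/

open Classical in
/-- THE LINEAR POTENTIAL of the constant plaquette field `h_{μν}` on the box `[lo, hi]` of `T^{(j)}`: `a_h(⟨z, ν⟩) = η·Σ_{μ<ν} h_{μν}·(z_μ − lo_μ)`
at the image of a box site `z` (well defined on non-wrapping boxes), `0` elsewhere — the local potential of the flux part of `f^{(k)}`, which is
not exact on the torus (p. 326: *"a local procedure since f^{(k)} can locally be represented as a curl"*). [cite: BalabanImbrieJaffe1985, §7.3 p.326] -/
def linPot (lo hi : Fin P.d → ℤ) (η : ℝ) (h : Fin P.d → Fin P.d → ℝ) : VecField P j ℝ := fun b =>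
  if hb : ∃ z : Fin P.d → ℤ, lo ≤ z ∧ z ≤ hi ∧ (castSite z : TSite P j) = b.src then
    η * ∑ μ : Fin P.d, (if μ < b.dir then h μ b.dir * (((Classical.choose hb) μ - lo μ : ℤ) : ℝ) else 0)
  else 0

/-- On a non-wrapping box the potential at `⟨z, ν⟩` IS the formula `η·Σ_{μ<ν} h_{μν}(z_μ − lo_μ)`. [cite: BalabanImbrieJaffe1985, §7.3 p.326] -/
theorem linPot_castSite {lo hi : Fin P.d → ℤ} (hN : ∀ κ, hi κ - lo κ < P.sitesPerDir j) (η : ℝ) (h : Fin P.d → Fin P.d → ℝ)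
    {z : Fin P.d → ℤ} (hz : lo ≤ z) (hz' : z ≤ hi) (ν : Fin P.d) :
    linPot lo hi η h (⟨castSite z, ν⟩ : PBond P j) = η * ∑ μ : Fin P.d, (if μ < ν then h μ ν * ((z μ - lo μ : ℤ) : ℝ) else 0) := by
  have hex : ∃ z' : Fin P.d → ℤ, lo ≤ z' ∧ z' ≤ hi ∧ (castSite z' : TSite P j) = castSite z := ⟨z, hz, hz', rfl⟩
  unfold linPot
  rw [dif_pos hex]
  obtain ⟨h1, h2, h3⟩ := Classical.choose_spec hex
  rw [castSite_injOn_box hN h1 h2 hz hz' h3]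

/-- Off the image of the box the potential vanishes. [cite: BalabanImbrieJaffe1985, §7.3 p.326] -/
theorem linPot_of_not_mem {lo hi : Fin P.d → ℤ} (η : ℝ) (h : Fin P.d → Fin P.d → ℝ) {b : PBond P j}
    (hb : ¬ ∃ z : Fin P.d → ℤ, lo ≤ z ∧ z ≤ hi ∧ (castSite z : TSite P j) = b.src) : linPot lo hi η h b = 0 := by
  unfold linPot
  rw [dif_neg hb]

/-- kernel: one step of the coordinate `λ` changes `Σ_{μ<ν} h_{μν}(z_μ − lo_μ)` by `h_{λν}` if `λ < ν`, not at all otherwise. [folklore] -/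
private theorem sum_step (h : Fin P.d → Fin P.d → ℝ) (lo z : Fin P.d → ℤ) (lam ν : Fin P.d) :
    ∑ μ : Fin P.d, (if μ < ν then h μ ν * (((z + e lam) μ - lo μ : ℤ) : ℝ) else 0)
      - ∑ μ : Fin P.d, (if μ < ν then h μ ν * ((z μ - lo μ : ℤ) : ℝ) else 0) = if lam < ν then h lam ν else 0 := by
  rw [← Finset.sum_sub_distrib]
  have hterm : ∀ μ : Fin P.d, ((if μ < ν then h μ ν * (((z + e lam) μ - lo μ : ℤ) : ℝ) else 0)
      - (if μ < ν then h μ ν * ((z μ - lo μ : ℤ) : ℝ) else 0)) = if μ = lam then (if lam < ν then h lam ν else 0) else 0 := by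
    intro μ
    by_cases hμ : μ = lam
    · subst hμ
      simp only [Pi.add_apply, e_apply, if_true]
      split_ifs <;> push_cast <;> ring
    · have : e lam μ = 0 := by rw [e_apply, if_neg hμ]
      simp only [Pi.add_apply, this, add_zero, sub_self, if_neg hμ]
  rw [Finset.sum_congr rfl fun μ _ => hterm μ, Finset.sum_ite_eq' Finset.univ lam, if_pos (Finset.mem_univ _)]

/-- **`∂^{c}a_h = (cη)·h` ON THE BOX PLAQUETTES** (so `= h` at `c = η⁻¹`): for `p = ⟨z; μ < ν⟩` with `z, z + e_μ + e_ν ∈ [lo, hi]` (non-wrapping box),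
`curl c (linPot lo hi η h) p = c·η·h_{μν}`. [cite: BalabanImbrieJaffe1985, §7.3 p.326] -/
theorem curl_linPot {lo hi : Fin P.d → ℤ} (hN : ∀ κ, hi κ - lo κ < P.sitesPerDir j) (c η : ℝ) (h : Fin P.d → Fin P.d → ℝ)
    {p : TPlaq P j} (hp : p ∈ boxPlaqs lo hi) : curl c (linPot lo hi η h) p = c * η * h p.μ p.ν := by
  obtain ⟨z, hlo, hhi, hsrc⟩ := hp
  have hμ0 := e_nonneg p.μ
  have hν0 := e_nonneg p.ν
  have hz' : z ≤ hi := ((le_add_of_nonneg_right hμ0).trans (le_add_of_nonneg_right hν0)).trans hhi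
  have hzμ : lo ≤ z + e p.μ := hlo.trans (le_add_of_nonneg_right hμ0)
  have hzμ' : z + e p.μ ≤ hi := (le_add_of_nonneg_right hν0).trans hhi
  have hzν : lo ≤ z + e p.ν := hlo.trans (le_add_of_nonneg_right hν0)
  have hzν' : z + e p.ν ≤ hi := by rw [add_right_comm] at hhi; exact (le_add_of_nonneg_right hμ0).trans hhi
  simp only [curl, hsrc, ← castSite_add_e, smul_eq_mul]
  rw [linPot_castSite hN η h hlo hz', linPot_castSite hN η h hzμ hzμ', linPot_castSite hN η h hzν hzν',
    linPot_castSite hN η h hlo hz']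
  have e1 := sum_step h lo z p.μ p.ν
  have e2 := sum_step h lo z p.ν p.μ
  rw [if_pos p.hμν] at e1
  rw [if_neg (not_lt.2 p.hμν.le)] at e2
  calc c * (η * ∑ μ, (if μ < p.μ then h μ p.μ * ((z μ - lo μ : ℤ) : ℝ) else 0)
        + η * ∑ μ, (if μ < p.ν then h μ p.ν * (((z + e p.μ) μ - lo μ : ℤ) : ℝ) else 0)
        - η * ∑ μ, (if μ < p.μ then h μ p.μ * (((z + e p.ν) μ - lo μ : ℤ) : ℝ) else 0)
        - η * ∑ μ, (if μ < p.ν then h μ p.ν * ((z μ - lo μ : ℤ) : ℝ) else 0))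
      = c * (η * (∑ μ, (if μ < p.ν then h μ p.ν * (((z + e p.μ) μ - lo μ : ℤ) : ℝ) else 0)
          - ∑ μ, (if μ < p.ν then h μ p.ν * ((z μ - lo μ : ℤ) : ℝ) else 0))
        - η * (∑ μ, (if μ < p.μ then h μ p.μ * (((z + e p.ν) μ - lo μ : ℤ) : ℝ) else 0)
          - ∑ μ, (if μ < p.μ then h μ p.μ * ((z μ - lo μ : ℤ) : ℝ) else 0))) := by ring
    _ = c * η * h p.μ p.ν := by rw [e1, e2]; ring

/-- **`|a_h(b)| ≤ η·d·n·s` EVERYWHERE** when `|h_{μν}| ≤ s`, `hi ≤ lo + n`, `η ≥ 0` (at most `d` terms `|h|·(z_μ − lo_μ) ≤ s·n`; `0` off the box).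
[cite: BalabanImbrieJaffe1985, §7.3 p.326] -/
theorem abs_linPot_le {lo hi : Fin P.d → ℤ} {n : ℕ} (hn : ∀ κ, hi κ ≤ lo κ + n) {η : ℝ} (hη : 0 ≤ η) {h : Fin P.d → Fin P.d → ℝ}
    {s : ℝ} (hs0 : 0 ≤ s) (hs : ∀ μ ν, |h μ ν| ≤ s) (b : PBond P j) : |linPot lo hi η h b| ≤ η * P.d * n * s := by
  unfold linPot
  split_ifs with hb
  · obtain ⟨h1, h2, -⟩ := Classical.choose_spec hb
    set z := Classical.choose hb
    rw [abs_mul, abs_of_nonneg hη, mul_assoc, mul_assoc]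
    refine mul_le_mul_of_nonneg_left ?_ hη
    calc |∑ μ : Fin P.d, (if μ < b.dir then h μ b.dir * ((z μ - lo μ : ℤ) : ℝ) else 0)|
        ≤ ∑ μ : Fin P.d, |(if μ < b.dir then h μ b.dir * ((z μ - lo μ : ℤ) : ℝ) else 0)| := Finset.abs_sum_le_sum_abs _ _
      _ ≤ ∑ _μ : Fin P.d, (n : ℝ) * s := Finset.sum_le_sum fun μ _ => by
          split_ifs with hμ
          · rw [abs_mul, mul_comm]
            have h0 : (0 : ℝ) ≤ ((z μ - lo μ : ℤ) : ℝ) := by exact_mod_cast sub_nonneg.2 (h1 μ)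
            have hzn : ((z μ - lo μ : ℤ) : ℝ) ≤ n := by
              have := h2 μ; have := hn μ
              have h3 : z μ - lo μ ≤ n := by linarith
              exact_mod_cast h3
            rw [abs_of_nonneg h0]
            exact mul_le_mul hzn (hs μ b.dir) (abs_nonneg _) (Nat.cast_nonneg _)
          · rw [abs_zero]; positivity
      _ = P.d * (n * s) := by rw [Finset.sum_const, Finset.card_univ, Fintype.card_fin, nsmul_eq_mul]
  · rw [abs_zero]; positivity

/-- **the forward differences of `a_h` are the constants**: for `z, z + e_λ ∈ [lo, hi]` (non-wrapping box),
`a_h(⟨z + e_λ, ν⟩) − a_h(⟨z, ν⟩) = η·h_{λν}` if `λ < ν`, `0` otherwise; hence `|c(a_h(⟨z + e_λ, ν⟩) − a_h(⟨z, ν⟩))| ≤ |c|η·s` when `|h| ≤ s`.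
[cite: BalabanImbrieJaffe1985, §7.3 p.326] -/
theorem abs_fwdDiff_linPot_le {lo hi : Fin P.d → ℤ} (hN : ∀ κ, hi κ - lo κ < P.sitesPerDir j) (c : ℝ) {η : ℝ} (hη : 0 ≤ η)
    {h : Fin P.d → Fin P.d → ℝ} {s : ℝ} (hs0 : 0 ≤ s) (hs : ∀ μ ν, |h μ ν| ≤ s) {z : Fin P.d → ℤ} (hz : lo ≤ z)
    (lam : Fin P.d) (hz' : z + e lam ≤ hi) (ν : Fin P.d) :
    |c * (linPot lo hi η h (⟨castSite (z + e lam), ν⟩ : PBond P j) - linPot lo hi η h (⟨castSite z, ν⟩ : PBond P j))| ≤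
      |c| * η * s := by
  have hz'' : z ≤ hi := (le_add_of_nonneg_right (e_nonneg lam)).trans hz'
  have hzl : lo ≤ z + e lam := hz.trans (le_add_of_nonneg_right (e_nonneg lam))
  rw [linPot_castSite hN η h hzl hz' ν, linPot_castSite hN η h hz hz'' ν, ← mul_sub, sum_step, abs_mul, abs_mul, abs_of_nonneg hη, mul_assoc]
  refine mul_le_mul_of_nonneg_left (mul_le_mul_of_nonneg_left ?_ hη) (abs_nonneg c)
  split_ifs
  · exact hs lam ν
  · rw [abs_zero]; exact hs0

/-! ## §3  Plaquette variables of `exp[ie_kηA]`; flat ratios -/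

/-- **`exp[ieηA](∂p) = exp(ieη²·(∂^{η⁻¹}A)(p))`** on the fine torus (`η⁻¹ = L^k`; p30's `plaq_expField`, `ηL^k = 1`).
[cite: BalabanImbrieJaffe1985, (4.5.1) p.312] -/
theorem plaq_expField_eq_exp_curl (k : ℕ) (e₀ : ℝ) (A : PBond P 0 → ℝ) (p : TPlaq P 0) :
    plaq (expField (e₀ * P.eta k) A) p = Circle.exp (e₀ * (P.eta k) ^ 2 * curl ((P.L : ℝ) ^ k) A p) := by
  rw [plaq_expField, curl_eq_mul_curl1]
  congr 1
  have h := eta_mul_L_pow P k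
  calc e₀ * P.eta k * curl1 A p = e₀ * P.eta k * (P.eta k * (P.L : ℝ) ^ k) * curl1 A p := by rw [h, mul_one]
    _ = e₀ * P.eta k ^ 2 * ((P.L : ℝ) ^ k * curl1 A p) := by ring

/-- kernel: plaquette variables are multiplicative and turn bondwise inverses into inverses (abelian group). [cite: BalabanImbrieJaffe1985, (2.5) p.302] -/
theorem plaq_mul_inv (u U : U1Field P j) (p : TPlaq P j) : plaq (fun b => u b * (U b)⁻¹) p = plaq u p * (plaq U p)⁻¹ := by
  simp only [plaq, mul_inv_rev, inv_inv]
  simp only [mul_comm, mul_left_comm, mul_assoc]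

/-- **equal plaquette variables ⇒ the ratio is FLAT**: `u(∂p) = U(∂p)` gives `(u·U⁻¹)(∂p) = 1`. [cite: BalabanImbrieJaffe1985, (2.5) p.302] -/
theorem plaq_ratio_eq_one {u U : U1Field P j} {p : TPlaq P j} (h : plaq u p = plaq U p) : plaq (fun b => u b * (U b)⁻¹) p = 1 := by
  rw [plaq_mul_inv, h, mul_inv_cancel]

/-! ## §4  The U(1) Poincaré lemma at plaquette bound `0`: equal plaquettes on a box ⇒ gauge equivalent there -/

/-- **TWO FINE `U(1)` FIELDS WITH THE SAME PLAQUETTE VARIABLES ON A NON-WRAPPING BOX DIFFER THERE BY A PURE GAUGE**: if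
`u(∂p) = exp[ie₀ηA](∂p)` for every plaquette of the box `[lo, hi]` (`hi ≤ lo + n`, `n < sitesPerDir j`, `e₀ > 0`), then there is a real gauge
function `λ` with `u(b) = exp(ie₀((∂₁λ)(b) + ηA(b)))` for EVERY bond `b` of the box — p36's corner-rooted axial gauge of the FLAT ratio
`u·exp[−ie₀ηA]` (`BIJ88Smooth43Axial.abs_axialB_le` at plaquette bound `a = 0` forces the axial potential to vanish; `cfg_eq_exp_grad_add_axialB`).
[cite: BalabanImbrieJaffe1985, §7.3 p.326] -/
theorem eq_exp_grad_add_of_plaq_eq {e₀ : ℝ} (he : 0 < e₀) (η : ℝ) (u : U1Field P j) (A : PBond P j → ℝ) {lo hi : Fin P.d → ℤ}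
    {n : ℕ} (hn : ∀ κ, hi κ ≤ lo κ + n) (hnN : n < P.sitesPerDir j)
    (hpl : ∀ p ∈ boxPlaqs lo hi, plaq u p = plaq (expField (e₀ * η) A) p) :
    ∃ lam : TSite P j → ℝ, ∀ b ∈ boxBonds lo hi, u b = Circle.exp (e₀ * (grad 1 lam b + η * A b)) := by
  set W : U1Field P j := fun b => u b * (expField (e₀ * η) A b)⁻¹ with hW
  have hflat : ∀ p ∈ boxPlaqs lo hi, |arg (plaqVar (cfg (fieldEquiv W)) p)| ≤ e₀ * 0 := by
    intro p hp
    rw [cfg_fieldEquiv, plaqVar_coe, plaq_ratio_eq_one (hpl p hp)]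
    simp
  refine ⟨fun x => lamOf (axialGauge (fieldEquiv W) lo hi) x / e₀, fun b hb => ?_⟩
  have hB0 : axialB e₀ (fieldEquiv W) lo hi b = 0 := by
    have h := abs_axialB_le he le_rfl (fieldEquiv W) hflat hn hnN b
    simp only [mul_zero] at h
    exact abs_nonpos_iff.1 h
  have hcfg := cfg_eq_exp_grad_add_axialB he.ne' (fieldEquiv W) hb
  rw [hB0, add_zero, cfg_fieldEquiv] at hcfg
  have hWb : W b = Circle.exp (e₀ * grad 1 (fun x => lamOf (axialGauge (fieldEquiv W) lo hi) x / e₀) b) := by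
    apply Circle.ext
    rw [Circle.coe_exp, mul_comm _ I]
    exact hcfg
  have hu : u b = W b * expField (e₀ * η) A b := by rw [hW]; exact (inv_mul_cancel_right (u b) _).symm
  rw [hu, hWb, show expField (e₀ * η) A b = Circle.exp (e₀ * η * A b) from rfl, ← Circle.exp_add]
  congr 1
  ring

/-! ## §5  One torus, one scale: the gauge from the curvature identity of file 1 -/

/-- **THE CHANGE OF GAUGE ON A BOX, GIVEN THE CURVATURE IDENTITY**: if `u_k(∂p) = exp(ie_kη²(h_{μν} + (∂^ηH_kB)(p)))` on every η-plaquette (file 1,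
`plaq_actualBg_eq_exp_hodge`), then on every non-wrapping box `[lo, hi]` (`hi ≤ lo + n`, `n < sitesPerDir 0`) there is `λ` with
`u_k(b) = exp(ie_k((∂₁λ)(b) + η·(H_kB + a_h)(b)))` for all box bonds (`a_h = linPot lo hi η h`; §2 `∂^ηa_h = h` there, §3, §4); `k ≤ m + K`, `e_k > 0`.
[cite: BalabanImbrieJaffe1985, §7.3 p.326] -/
theorem exists_gauge_of_hodge (hd : 2 ≤ P.d) (k : ℕ) {e₀ : ℝ} (he : 0 < e₀) (v : U1Field P k)
    {h : Fin P.d → Fin P.d → ℝ} {B : PBond P k → ℝ}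
    (hplaq : ∀ p : TPlaq P 0, plaq (actualBg hd k e₀ v) p = Circle.exp (e₀ * (P.eta k) ^ 2 *
      (h p.μ p.ν + curl ((P.L : ℝ) ^ k) (WithLp.ofLp (HkE P ((P.eta k) ^ P.d) ((P.L : ℝ) ^ k) k (toEj P k B))) p)))
    {lo hi : Fin P.d → ℤ} {n : ℕ} (hn : ∀ κ, hi κ ≤ lo κ + n) (hnN : n < P.sitesPerDir 0) :
    ∃ lam : TSite P 0 → ℝ, ∀ b ∈ boxBonds lo hi,
      actualBg hd k e₀ v b = Circle.exp (e₀ * (grad 1 lam b + P.eta k *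
        (WithLp.ofLp (HkE P ((P.eta k) ^ P.d) ((P.L : ℝ) ^ k) k (toEj P k B)) b + linPot lo hi (P.eta k) h b))) := by
  have hN : ∀ κ, hi κ - lo κ < P.sitesPerDir 0 := fun κ => by
    have h1 := hn κ
    have h2 : (n : ℤ) < P.sitesPerDir 0 := by exact_mod_cast hnN
    linarith
  refine eq_exp_grad_add_of_plaq_eq he (P.eta k) (actualBg hd k e₀ v)
    (fun b => WithLp.ofLp (HkE P ((P.eta k) ^ P.d) ((P.L : ℝ) ^ k) k (toEj P k B)) b + linPot lo hi (P.eta k) h b) hn hnN ?_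
  intro p hp
  rw [hplaq p, plaq_expField_eq_exp_curl k, curl_add, curl_linPot hN ((P.L : ℝ) ^ k) (P.eta k) h hp]
  congr 1
  have h1 : (P.L : ℝ) ^ k * P.eta k = 1 := by rw [mul_comm]; exact eta_mul_L_pow P k
  rw [h1, one_mul]
  ring

/-! ## §6  ALL TORI, HYPOTHESIS-FREE: the p. 326 remark with one constant for all tori and scales -/

/-- kernel: `X ≤ (1 + d(X + 1))²` and `1 ≤ (1 + d(X + 1))²` for `X ≥ 0`, `d ≥ 1` (absorbing the linear potential into the growth weight). [folklore] -/
private theorem weight_absorb {d : ℕ} (hd : 1 ≤ d) {X : ℝ} (hX : 0 ≤ X) :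
    1 ≤ (1 + (d : ℝ) * (X + 1)) ^ 2 ∧ X ≤ (1 + (d : ℝ) * (X + 1)) ^ 2 := by
  have hd1 : (1 : ℝ) ≤ d := by exact_mod_cast hd
  have h1 : 1 + X ≤ 1 + (d : ℝ) * (X + 1) := by nlinarith
  have h2 : 1 ≤ 1 + (d : ℝ) * (X + 1) := by nlinarith
  have h3 : 1 + (d : ℝ) * (X + 1) ≤ (1 + (d : ℝ) * (X + 1)) ^ 2 := by nlinarith
  exact ⟨h2.trans h3, by linarith⟩

/-- **THE p. 326 REMARK — «BY CHANGE OF GAUGE u_k CAN BE TRANSFORMED IN A LOCAL REGION Λ INTO A CONFIGURATION OF THE FORM exp[ie_kηA], WHERE A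
IS SMOOTH AND SMALL» — HYPOTHESIS-FREE, ONE CONSTANT FOR ALL TORI AND ALL SCALES.**  For every dimension `d ≥ 2` and block size `L` there is
`K ≥ 0` such that on EVERY torus `P` (`P.d = d`, `P.L = L`; any volume exponent `m`, any number of steps `K`), at every scale `1 ≤ k ≤ m + K`, for
every coupling `e > 0`, every unit-lattice `U(1)` field `v` with `|v(∂p) − 1| ≤ t ≤ ½` (under (7.3.1): `t = e_k𝓅(e_k)`), and every box
`Λ = [lo, hi]` of the η-torus with `hi ≤ lo + n`, `n < sitesPerDir 0` (no wrap-around), there are a real gauge function `λ` and a real η-bond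
field `A` (the Landau minimizer `H_kB` of file 1 plus the linear potential of the flux part) with
(a) `u_k(b) = exp(ie((∂₁λ)(b) + ηA(b)))` for EVERY bond `b` of `Λ` (the actual background (4.5.4), `BIJ85Eq454PlaqResidual.actualBg`);
(b) `|A(b)| ≤ K·(1 + d(nη + 1))²·(t/e)` for every bond of `Λ`;
(c) `|L^k(A(⟨z + e_λ, ν⟩) − A(⟨z, ν⟩))| ≤ K·(1 + d(nη + 1))²·(t/e)` for all `z, z + e_λ ∈ Λ` and all `ν` — ALL forward η-difference quotients
(*"smooth … with estimates depending on Λ"*: `nη` is the side of `Λ` in the unit of `T₁^{(k)}`).  `K = K₁ + πd` with `K₁` the constant of file 1's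
`exists_smooth_potential_allTori` (the `|H|`, `|∇H|` members of (7.2.2) over all tori ← [6I] Prop. 1.2 over all tori, p19's `prop12Printed_allTori`).
[cite: BalabanImbrieJaffe1985, §7.3 p.326; Balaban1984PropagatorsI, Prop. 1.2 (1.110)–(1.114) pp.35–36] -/
theorem exists_local_smooth_gauge_allTori {d L : ℕ} (hd : 2 ≤ d) (hL : Odd L ∧ 1 < L) :
    ∃ K : ℝ, 0 ≤ K ∧ ∀ (P : Params) (hPd : P.d = d), P.L = L → ∀ (k : ℕ), 1 ≤ k → ∀ (hk : k ≤ P.m + P.K)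
      (e₀ : ℝ), 0 < e₀ → ∀ (v : U1Field P k) (t : ℝ), t ≤ 1 / 2 → (∀ p : TPlaq P k, ‖((plaq v p : Circle) : ℂ) - 1‖ ≤ t) →
      ∀ (lo hi : Fin P.d → ℤ) (n : ℕ), (∀ κ, hi κ ≤ lo κ + n) → n < P.sitesPerDir 0 →
      ∃ (lam : TSite P 0 → ℝ) (A : PBond P 0 → ℝ),
        (∀ b ∈ boxBonds lo hi, actualBg (hd.trans_eq hPd.symm) k e₀ v b = Circle.exp (e₀ * (grad 1 lam b + P.eta k * A b))) ∧
        (∀ b ∈ boxBonds lo hi, |A b| ≤ K * (1 + (d : ℝ) * ((n : ℝ) * P.eta k + 1)) ^ 2 * (t / e₀)) ∧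
        (∀ (z : Fin P.d → ℤ) (lam' ν : Fin P.d), lo ≤ z → z + e lam' ≤ hi →
          |(P.L : ℝ) ^ k * (A ⟨castSite (z + e lam'), ν⟩ - A ⟨castSite z, ν⟩)| ≤
            K * (1 + (d : ℝ) * ((n : ℝ) * P.eta k + 1)) ^ 2 * (t / e₀)) := by
  have hd1 : 1 ≤ d := le_trans (by norm_num) hd
  obtain ⟨K₁, hK₁, hall⟩ := exists_smooth_potential_allTori hd hL
  refine ⟨K₁ + Real.pi * d, by positivity, ?_⟩
  intro P hPd hPL k hk1 hk e₀ he v t ht hv lo hi n hn hnN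
  obtain ⟨h, B, hh, -, -, -, hplaq, hval, hgrad⟩ := hall P hPd hPL k hk1 hk e₀ he v t ht hv (blk k (castSite lo : TSite P 0))
  subst hPd
  have hN : ∀ κ, hi κ - lo κ < P.sitesPerDir 0 := fun κ => by
    have h1 := hn κ
    have h2 : (n : ℤ) < P.sitesPerDir 0 := by exact_mod_cast hnN
    linarith
  have hη : 0 ≤ P.eta k := (eta_pos P k).le
  have hte : 0 ≤ t / e₀ := div_nonneg (dev_nonneg hd v hv) he.le
  have hs0 : 0 ≤ Real.pi / 2 * t / e₀ := by rw [mul_div_assoc]; positivity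
  set W : ℝ := (1 + (P.d : ℝ) * ((n : ℝ) * P.eta k + 1)) ^ 2 with hWdef
  obtain ⟨hW1, hWn⟩ := weight_absorb hd1 (X := (n : ℝ) * P.eta k) (by positivity)
  set A₁ : PBond P 0 → ℝ := fun b => WithLp.ofLp (HkE P ((P.eta k) ^ P.d) ((P.L : ℝ) ^ k) k (toEj P k B)) b with hA₁
  obtain ⟨lam, hlam⟩ := exists_gauge_of_hodge hd k he v hplaq hn hnN
  refine ⟨lam, fun b => A₁ b + linPot lo hi (P.eta k) h b, hlam, fun b hb => ?_, fun z lam' ν hz hz' => ?_⟩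
  · -- the sup of `A` on the box
    obtain ⟨x, hx, hxd, hsrc⟩ := hb
    have hx' : x ≤ hi := (le_add_of_nonneg_right (e_nonneg b.dir)).trans hxd
    have hw : (1 + ((blk k b.src).tdist (blk k (castSite lo : TSite P 0)) : ℝ)) ^ 2 ≤ W := by
      rw [hsrc, hWdef]
      have ht := tdist_blk_le_of_box hk hn hx hx'
      have h0 : (0 : ℝ) ≤ ((blk k (castSite x : TSite P 0)).tdist (blk k (castSite lo : TSite P 0)) : ℝ) := Nat.cast_nonneg _
      nlinarith
    have h1 : |A₁ b| ≤ K₁ * (t / e₀) * W := by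
      have := hval b.src b.dir
      exact this.trans (mul_le_mul_of_nonneg_left hw (by positivity))
    have h2 : |linPot lo hi (P.eta k) h b| ≤ Real.pi / 2 * (P.d : ℝ) * W * (t / e₀) := by
      have h3 := abs_linPot_le (j := 0) hn hη hs0 hh b
      calc |linPot lo hi (P.eta k) h b| ≤ P.eta k * P.d * n * (Real.pi / 2 * t / e₀) := h3
        _ = Real.pi / 2 * (P.d : ℝ) * ((n : ℝ) * P.eta k) * (t / e₀) := by ring
        _ ≤ Real.pi / 2 * (P.d : ℝ) * W * (t / e₀) := by gcongr
    have h4 : Real.pi / 2 * (P.d : ℝ) * W * (t / e₀) ≤ Real.pi * (P.d : ℝ) * W * (t / e₀) := by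
      have : 0 ≤ (P.d : ℝ) * W * (t / e₀) := by positivity
      nlinarith [Real.pi_pos]
    calc |A₁ b + linPot lo hi (P.eta k) h b| ≤ |A₁ b| + |linPot lo hi (P.eta k) h b| := abs_add_le _ _
      _ ≤ K₁ * (t / e₀) * W + Real.pi * (P.d : ℝ) * W * (t / e₀) := add_le_add h1 (h2.trans h4)
      _ = (K₁ + Real.pi * P.d) * W * (t / e₀) := by ring
  · -- all forward η-difference quotients of `A` on the box
    have hz'' : z ≤ hi := (le_add_of_nonneg_right (e_nonneg lam')).trans hz'
    have hw : (1 + ((blk k (castSite z : TSite P 0)).tdist (blk k (castSite lo : TSite P 0)) : ℝ)) ^ 2 ≤ W := by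
      rw [hWdef]
      have ht := tdist_blk_le_of_box hk hn hz hz''
      have h0 : (0 : ℝ) ≤ ((blk k (castSite z : TSite P 0)).tdist (blk k (castSite lo : TSite P 0)) : ℝ) := Nat.cast_nonneg _
      nlinarith
    have h1 : |(P.L : ℝ) ^ k * (A₁ ⟨castSite (z + e lam'), ν⟩ - A₁ ⟨castSite z, ν⟩)| ≤ K₁ * (t / e₀) * W := by
      have := hgrad (castSite z) ν lam'
      rw [← castSite_add_e] at this
      exact this.trans (mul_le_mul_of_nonneg_left hw (by positivity))
    have h2 : |(P.L : ℝ) ^ k * (linPot (j := 0) lo hi (P.eta k) h ⟨castSite (z + e lam'), ν⟩ - linPot (j := 0) lo hi (P.eta k) h ⟨castSite z, ν⟩)| ≤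
        Real.pi / 2 * (t / e₀) := by
      have h3 := abs_fwdDiff_linPot_le (j := 0) hN ((P.L : ℝ) ^ k) hη hs0 hh hz lam' hz' ν
      rw [abs_of_pos (pow_pos P.cast_L_pos k), mul_comm ((P.L : ℝ) ^ k) (P.eta k), eta_mul_L_pow, one_mul] at h3
      rw [mul_div_assoc] at h3
      exact h3
    have h4 : Real.pi / 2 * (t / e₀) ≤ Real.pi * (P.d : ℝ) * W * (t / e₀) := by
      have hd1' : (1 : ℝ) ≤ P.d := by exact_mod_cast hd1
      have hdW : (1 : ℝ) / 2 ≤ (P.d : ℝ) * W := by nlinarith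
      calc Real.pi / 2 * (t / e₀) = Real.pi * (1 / 2) * (t / e₀) := by ring
        _ ≤ Real.pi * ((P.d : ℝ) * W) * (t / e₀) := by gcongr
        _ = Real.pi * (P.d : ℝ) * W * (t / e₀) := by ring
    calc |(P.L : ℝ) ^ k * (A₁ ⟨castSite (z + e lam'), ν⟩ + linPot (j := 0) lo hi (P.eta k) h ⟨castSite (z + e lam'), ν⟩
            - (A₁ ⟨castSite z, ν⟩ + linPot (j := 0) lo hi (P.eta k) h ⟨castSite z, ν⟩))|
        = |(P.L : ℝ) ^ k * (A₁ ⟨castSite (z + e lam'), ν⟩ - A₁ ⟨castSite z, ν⟩)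
            + (P.L : ℝ) ^ k * (linPot (j := 0) lo hi (P.eta k) h ⟨castSite (z + e lam'), ν⟩ - linPot (j := 0) lo hi (P.eta k) h ⟨castSite z, ν⟩)| := by
          ring_nf
      _ ≤ |(P.L : ℝ) ^ k * (A₁ ⟨castSite (z + e lam'), ν⟩ - A₁ ⟨castSite z, ν⟩)|
            + |(P.L : ℝ) ^ k * (linPot (j := 0) lo hi (P.eta k) h ⟨castSite (z + e lam'), ν⟩ - linPot (j := 0) lo hi (P.eta k) h ⟨castSite z, ν⟩)| :=
          abs_add_le _ _
      _ ≤ K₁ * (t / e₀) * W + Real.pi * (P.d : ℝ) * W * (t / e₀) := add_le_add h1 (h2.trans h4)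
      _ = (K₁ + Real.pi * P.d) * W * (t / e₀) := by ring

/-- **UNDER (7.3.1) VERBATIM** (`|v(∂p) − 1| ≤ e_k𝓅(e_k)`, `𝓅(e_k) = (1 + ln e_k⁻¹)^𝓅`, `e_k𝓅(e_k) ≤ ½`): the same with the factor `t/e` replaced
by `𝓅(e_k)` — on every non-wrapping box `Λ` of every torus, at every scale `1 ≤ k ≤ m + K`, `u_k = exp[ie_k(∂λ + ηA)]` on `Λ` with
`|A|, |L^k(A(· + ηe_λ) − A)| ≤ K·(1 + d(|Λ|η + 1))²·𝓅(e_k)` — *"where A is smooth and small"*. [cite: BalabanImbrieJaffe1985, (7.3.1) p.326, §7.3 p.326] -/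
theorem exists_local_smooth_gauge_of_hyp731 {d L : ℕ} (hd : 2 ≤ d) (hL : Odd L ∧ 1 < L) (pexp : ℝ) :
    ∃ K : ℝ, 0 ≤ K ∧ ∀ (P : Params) (hPd : P.d = d), P.L = L → ∀ (k : ℕ), 1 ≤ k → ∀ (hk : k ≤ P.m + P.K)
      (e₀ : ℝ), 0 < e₀ → e₀ * (1 + Real.log e₀⁻¹) ^ pexp ≤ 1 / 2 →
      ∀ (v : U1Field P k), (∀ p : TPlaq P k, ‖((plaq v p : Circle) : ℂ) - 1‖ ≤ e₀ * (1 + Real.log e₀⁻¹) ^ pexp) →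
      ∀ (lo hi : Fin P.d → ℤ) (n : ℕ), (∀ κ, hi κ ≤ lo κ + n) → n < P.sitesPerDir 0 →
      ∃ (lam : TSite P 0 → ℝ) (A : PBond P 0 → ℝ),
        (∀ b ∈ boxBonds lo hi, actualBg (hd.trans_eq hPd.symm) k e₀ v b = Circle.exp (e₀ * (grad 1 lam b + P.eta k * A b))) ∧
        (∀ b ∈ boxBonds lo hi, |A b| ≤ K * (1 + (d : ℝ) * ((n : ℝ) * P.eta k + 1)) ^ 2 * (1 + Real.log e₀⁻¹) ^ pexp) ∧
        (∀ (z : Fin P.d → ℤ) (lam' ν : Fin P.d), lo ≤ z → z + e lam' ≤ hi →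
          |(P.L : ℝ) ^ k * (A ⟨castSite (z + e lam'), ν⟩ - A ⟨castSite z, ν⟩)| ≤
            K * (1 + (d : ℝ) * ((n : ℝ) * P.eta k + 1)) ^ 2 * (1 + Real.log e₀⁻¹) ^ pexp) := by
  obtain ⟨K, hK, hall⟩ := exists_local_smooth_gauge_allTori hd hL
  refine ⟨K, hK, fun P hPd hPL k hk1 hk e₀ he hsmall v hv lo hi n hn hnN => ?_⟩
  obtain ⟨lam, A, hform, hsup, hgrad⟩ := hall P hPd hPL k hk1 hk e₀ he v _ hsmall hv lo hi n hn hnN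
  have hte : e₀ * (1 + Real.log e₀⁻¹) ^ pexp / e₀ = (1 + Real.log e₀⁻¹) ^ pexp := mul_div_cancel_left₀ _ he.ne'
  exact ⟨lam, A, hform, fun b hb => (hsup b hb).trans_eq (by rw [hte]), fun z lam' ν hz hz' => (hgrad z lam' ν hz hz').trans_eq (by rw [hte])⟩

/-- **Per-torus unpacking** (same constant as `exists_local_smooth_gauge_of_hyp731` at `(P.d, P.L)`): for every torus `P` with `d ≥ 2` and every
exponent `𝓅` there is `K ≥ 0` serving every scale `1 ≤ k ≤ m + K`, every `e_k` with `e_k𝓅(e_k) ≤ ½`, every `v` under (7.3.1) and every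
non-wrapping box. [cite: BalabanImbrieJaffe1985, §7.3 p.326] -/
theorem exists_local_smooth_gauge_of_hyp731_torus (P : Params) (hd : 2 ≤ P.d) (pexp : ℝ) :
    ∃ K : ℝ, 0 ≤ K ∧ ∀ (k : ℕ), 1 ≤ k → ∀ (hk : k ≤ P.m + P.K)
      (e₀ : ℝ), 0 < e₀ → e₀ * (1 + Real.log e₀⁻¹) ^ pexp ≤ 1 / 2 →
      ∀ (v : U1Field P k), (∀ p : TPlaq P k, ‖((plaq v p : Circle) : ℂ) - 1‖ ≤ e₀ * (1 + Real.log e₀⁻¹) ^ pexp) →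
      ∀ (lo hi : Fin P.d → ℤ) (n : ℕ), (∀ κ, hi κ ≤ lo κ + n) → n < P.sitesPerDir 0 →
      ∃ (lam : TSite P 0 → ℝ) (A : PBond P 0 → ℝ),
        (∀ b ∈ boxBonds lo hi, actualBg hd k e₀ v b = Circle.exp (e₀ * (grad 1 lam b + P.eta k * A b))) ∧
        (∀ b ∈ boxBonds lo hi, |A b| ≤ K * (1 + (P.d : ℝ) * ((n : ℝ) * P.eta k + 1)) ^ 2 * (1 + Real.log e₀⁻¹) ^ pexp) ∧
        (∀ (z : Fin P.d → ℤ) (lam' ν : Fin P.d), lo ≤ z → z + e lam' ≤ hi →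
          |(P.L : ℝ) ^ k * (A ⟨castSite (z + e lam'), ν⟩ - A ⟨castSite z, ν⟩)| ≤
            K * (1 + (P.d : ℝ) * ((n : ℝ) * P.eta k + 1)) ^ 2 * (1 + Real.log e₀⁻¹) ^ pexp) := by
  obtain ⟨K, hK, hall⟩ := exists_local_smooth_gauge_of_hyp731 (L := P.L) hd P.hL pexp
  exact ⟨K, hK, fun k hk1 hk e₀ he hsmall v hv lo hi n hn hnN => hall P rfl rfl k hk1 hk e₀ he hsmall v hv lo hi n hn hnN⟩

/-! ## §7  Row C2.Eq4.3 of [BalabanImbrieJaffe1988] for the actual background: r18's `Smooth43` at lattice spacing `ζ = η` -/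

/-- kernel: one lattice step BACK commutes with the projection, `castSite (z − e_μ) = (castSite z) − e_μ` on the torus. [folklore] -/
private theorem castSite_sub_e (z : Fin P.d → ℤ) (μ : Fin P.d) : (castSite (z - e μ) : TSite P j) = (castSite z).unshift μ := by
  funext κ
  simp only [castSite_apply, Balaban1983to89.Site.unshift, Function.update_apply, Pi.sub_apply, e_apply]
  split_ifs with h
  · subst h; push_cast; ring
  · simp

/-- **THE REGULARITY CONDITION (4.3) OF [BalabanImbrieJaffe1988] FOR THE ACTUAL BACKGROUND `u_k` AT THE FINE LATTICE SPACING `ζ = η`, HYPOTHESIS-FREE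
UP TO THE SMALL PLAQUETTE VARIABLES OF `v`** (p. 274: *"there exists a gauge transformation u_k → u_k^λ such that u^λ_{k,b} = exp(ie_jL^{−j}A^λ_b)
with |A^λ_b|, |(∂^ζA^λ)(p)|, |(∂^{ζ*}A^λ)(x)| ≦ cp(e_j)r(e_j) (4.3) in □"*; the η-lattice passage named as open in p36's `BIJ88Smooth43Axial`):
for every `d ≥ 2`, `L` there is `K ≥ 0` such that on every torus (`P.d = d`, `P.L = L`), every scale `1 ≤ k ≤ m + K`, every `e > 0`, every
unit field `v` with `|v(∂p) − 1| ≤ t ≤ ½`, every non-wrapping box `[lo, hi]` (`hi ≤ lo + n`, `n < sitesPerDir 0`) and all finite sets `X`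
of INTERIOR box sites (`lo + 1 ≤ z ≤ hi`), `Bs` of box bonds, `Pl` of box plaquettes, r18's `Smooth43 e η c (t/e) 1 X Bs Pl (cfg u_k)` holds
with `c = 2dK(1 + d(nη + 1))²` — for the ℂ-valued reading `cfg (actualBgU1 …)` of p33 g7's actual background (4.5.4).  Under (7.3.1)
`t/e = 𝓅(e_k)`. [cite: BalabanImbrieJaffe1988, (4.3) p.274; BalabanImbrieJaffe1985, §7.3 p.326] -/
theorem smooth43_actualBg_allTori {d L : ℕ} (hd : 2 ≤ d) (hL : Odd L ∧ 1 < L) :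
    ∃ K : ℝ, 0 ≤ K ∧ ∀ (P : Params) (hPd : P.d = d), P.L = L → ∀ (k : ℕ), 1 ≤ k → ∀ (hk : k ≤ P.m + P.K)
      (e₀ : ℝ), 0 < e₀ → ∀ (v : U1Field P k) (t : ℝ), t ≤ 1 / 2 → (∀ p : TPlaq P k, ‖((plaq v p : Circle) : ℂ) - 1‖ ≤ t) →
      ∀ (lo hi : Fin P.d → ℤ) (n : ℕ), (∀ κ, hi κ ≤ lo κ + n) → n < P.sitesPerDir 0 →
      ∀ (X : Finset (TSite P 0)) (Bs : Finset (PBond P 0)) (Pl : Finset (TPlaq P 0)),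
        (∀ x ∈ X, ∃ z : Fin P.d → ℤ, (∀ κ, lo κ + 1 ≤ z κ) ∧ z ≤ hi ∧ (castSite z : TSite P 0) = x) →
        (∀ b ∈ Bs, b ∈ boxBonds lo hi) → (∀ p ∈ Pl, p ∈ boxPlaqs lo hi) →
        Smooth43 e₀ (P.eta k) (2 * d * K * (1 + (d : ℝ) * ((n : ℝ) * P.eta k + 1)) ^ 2) (t / e₀) 1 X Bs Pl
          (cfg (actualBgU1 (hd.trans_eq hPd.symm) k e₀ v)) := by
  obtain ⟨K, hK, hall⟩ := exists_local_smooth_gauge_allTori hd hL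
  refine ⟨K, hK, fun P hPd hPL k hk1 hk e₀ he v t ht hv lo hi n hn hnN X Bs Pl hX hBs hPl => ?_⟩
  obtain ⟨lam, A, hform, hsup, hgrad⟩ := hall P hPd hPL k hk1 hk e₀ he v t ht hv lo hi n hn hnN
  subst hPd
  have hd1 : (1 : ℝ) ≤ P.d := by exact_mod_cast (le_trans (by norm_num) hd : 1 ≤ P.d)
  set W : ℝ := (1 + (P.d : ℝ) * ((n : ℝ) * P.eta k + 1)) ^ 2 with hWdef
  have hte : 0 ≤ t / e₀ := div_nonneg (dev_nonneg hd v hv) he.le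
  have hKW : 0 ≤ K * W * (t / e₀) := by positivity
  refine ⟨fun x => e₀ * lam x, A, fun b hb => ?_, fun b hb => ?_, fun p hp => ?_, fun x hx => ?_⟩
  · -- (a) the gauge transformation: `u^λ_{k,b} = exp(ie_kηA_b)`
    have hf := hform b (hBs b hb)
    simp only [gaugeU, actualBgU1, cfg_fieldEquiv]
    rw [hf, Circle.coe_exp, ← Complex.exp_add, ← Complex.exp_add]
    congr 1
    simp only [grad, one_smul]
    push_cast
    ring
  · -- (b) `|A^λ_b|`
    refine (hsup b (hBs b hb)).trans ?_
    rw [mul_one]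
    have : K * W * (t / e₀) ≤ 2 * P.d * K * W * (t / e₀) := by nlinarith
    simpa [hWdef, mul_assoc] using this
  · -- (c) `|(∂^ζA^λ)(p)|`: a difference of two forward η-difference quotients
    obtain ⟨z, hlo, hhi, hsrc⟩ := hPl p hp
    have hμ0 := e_nonneg p.μ
    have hν0 := e_nonneg p.ν
    have hzμ' : z + e p.μ ≤ hi := (le_add_of_nonneg_right hν0).trans hhi
    have hzν' : z + e p.ν ≤ hi := by rw [add_right_comm] at hhi; exact (le_add_of_nonneg_right hμ0).trans hhi
    have h1 := hgrad z p.μ p.ν hlo hzμ'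
    have h2 := hgrad z p.ν p.μ hlo hzν'
    rw [eta_inv, mul_one]
    have e1 : curl ((P.L : ℝ) ^ k) A p = (P.L : ℝ) ^ k * (A ⟨castSite (z + e p.μ), p.ν⟩ - A ⟨castSite z, p.ν⟩)
        - (P.L : ℝ) ^ k * (A ⟨castSite (z + e p.ν), p.μ⟩ - A ⟨castSite z, p.μ⟩) := by
      simp only [curl, hsrc, ← castSite_add_e, smul_eq_mul]
      ring
    rw [e1]
    calc |(P.L : ℝ) ^ k * (A ⟨castSite (z + e p.μ), p.ν⟩ - A ⟨castSite z, p.ν⟩)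
          - (P.L : ℝ) ^ k * (A ⟨castSite (z + e p.ν), p.μ⟩ - A ⟨castSite z, p.μ⟩)|
        ≤ K * W * (t / e₀) + K * W * (t / e₀) := (abs_sub _ _).trans (add_le_add h1 h2)
      _ ≤ 2 * P.d * K * W * (t / e₀) := by nlinarith
  · -- (d) `|(∂^{ζ*}A^λ)(x)|` at an interior site: `d` backward steps, each a forward difference quotient one step back
    obtain ⟨z, hlo1, hhi, hxz⟩ := hX x hx
    rw [eta_inv, mul_one]
    unfold diverg
    have hterm : ∀ μ : Fin P.d, |(P.L : ℝ) ^ k • (A ⟨x.unshift μ, μ⟩ - A ⟨x, μ⟩)| ≤ K * W * (t / e₀) := by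
      intro μ
      have hz0 : lo ≤ z - e μ := fun κ => by
        have h1 := hlo1 κ
        have h2 : e μ κ ≤ 1 := by rw [e_apply]; split_ifs <;> norm_num
        simp only [Pi.sub_apply]
        linarith
      have hz1 : z - e μ + e μ ≤ hi := by rw [sub_add_cancel]; exact hhi
      have h := hgrad (z - e μ) μ μ hz0 hz1
      rw [sub_add_cancel] at h
      rw [← hxz, ← castSite_sub_e, smul_eq_mul, ← abs_neg]
      refine le_of_eq_of_le ?_ h
      congr 1
      ring
    calc |∑ μ : Fin P.d, (P.L : ℝ) ^ k • (A ⟨x.unshift μ, μ⟩ - A ⟨x, μ⟩)|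
        ≤ ∑ μ : Fin P.d, |(P.L : ℝ) ^ k • (A ⟨x.unshift μ, μ⟩ - A ⟨x, μ⟩)| := Finset.abs_sum_le_sum_abs _ _
      _ ≤ ∑ _μ : Fin P.d, K * W * (t / e₀) := Finset.sum_le_sum fun μ _ => hterm μ
      _ = P.d * (K * W * (t / e₀)) := by rw [Finset.sum_const, Finset.card_univ, Fintype.card_fin, nsmul_eq_mul]
      _ ≤ 2 * P.d * K * W * (t / e₀) := by nlinarith

end

end Literature.MathematicalPhysics.QuantumFieldTheory.BalabanImbrieJaffe1984to88.BIJ85LocalSmoothGauge326
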